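/-
HODGE LADDER — STAGE 4: the strict road (S) — DOMINATION DESCENDS ALONG SURJECTIVE MORPHISMS.  Arapura 2006 §1
Cor. 1.2: "`Y` is motivated by `X` if there exists a surjective morphism of varieties `f : Xⁿ → Y`" (proof: "`f_*` is
also surjective").  On the tree's real carriers: `Z` dominated by the powers of `A` and `f : Z ↠ Y` a surjective
morphism of smooth projective complex varieties ⟹ `Y` dominated by the powers of `A`; so `HC_AV` ALONE gives the
Hodge conjecture, with all powers, for every smooth projective image of a finite product of curves and abelian
varieties (symmetric powers of curves, smooth quotients `(C₁ × ⋯ × C_r)/G`, `A/G`, …) — KERNEL theorems, NO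
Literature record (literature seat hodge-director-lit-stage4, gen 12).  Theorems only: no definition, no named fact,
no new target.  Companion document run/shared/lean/pub/hodge-director/STAGE4-ABELIAN-MOTIVIC-TYPE.md (v12, §15).
-/
import Summits.HodgeConjecture.CorCM.Stage4StrictRoadCurves
import Literature.AlgebraicGeometry.HodgeTheory.ComplexGysinSurjective
import HarnessLib

/-!
# Stage 4 — the strict road: domination by an abelian variety descends along surjective morphisms

`CorCM/Stage4StrictRoadCurves` (gen 12, v1) typed Arapura's base case of strong motivation by an abelian variety —
a smooth projective complex curve is dominated by the powers of its Jacobian (Arapura 2006 §1 Lemma 1.3) — and the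
closure of «dominated by the powers of SOME abelian variety» under products, whence `HC_AV` alone gives the Hodge
conjecture for every finite product of curves and abelian varieties and all its powers
(`hc_of_exists_isDominatedByPowers_abelianVariety`, Arapura Lemma 4.2 = the kernel theorem
`hc_of_isDominatedByPowers_abelianVariety_holds` of gen 7).  This file adds the other printed closure property,
Arapura 2006 §1 Cor. 1.2 (Adv. Math. 207 (2006); held arXiv text math/0501348 «Corollary 2»): "`Y` is motivated by
`X` if there exists a surjective morphism of varieties `f : Xⁿ → Y`.  Proof. By taking general hyperplane sections, we
can find a smooth `g : Z ↪ Xⁿ` such that `h = f ∘ g` is surjective, and `dim Z = dim Y`. The map `h_* : H(Z) → H(Y)`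
is surjective since `(1/deg h) h^*` splits it. There[fore] `f_*` is also surjective."  In the tree the surjectivity
of `f_*` for ANY surjective morphism of smooth projective complex varieties is the theorem
`complexGysin_surjective_of_surjective` (`HodgeTheory/ComplexGysinSurjective`: Voisin I Lemma 7.28, `f^*` injective,
transposed by Poincaré duality), so the hyperplane-section step is not needed; `f_*` is an algebraic correspondence
(`isAlgebraicCorrespondence_complexGysin`) and composites of algebraic correspondences are algebraic
(`IsAlgebraicCorrespondence.comp`).  Recorded here, as kernel theorems with no record:

* `dim_le_of_surjective` — a surjective morphism `Z ↠ Y` of smooth projective complex varieties has `dim Y ≤ dim Z`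
  (`f^*` injective on `H^{2 dim Y}`, which is a line on `Y` and zero on `Z` if `dim Z < dim Y`);
* `isDominatedByPowers_of_surjective` — **domination by the powers of `A` descends from `Z` to `Y` along `Z ↠ Y`**;
  `exists_isDominatedByPowers_of_surjective`, `exists_isDominatedByPowers_pow_succ` (closure of «dominated by some
  abelian variety» under surjective images and powers);
* from `HC_AV` alone: `hc_of_surjective_of_exists_isDominatedByPowers` and the instances
  `hc_of_surjective_from_abelianVariety` (smooth images of an abelian variety, e.g. bielliptic surfaces `A/G`),
  `hc_of_surjective_from_curve_tensor_curve` (smooth images of `C₁ × C₂`, e.g. `C^{(2)}`),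
  `hc_of_surjective_from_curve_pow` (smooth images of `C^{m+1}`, e.g. the symmetric powers `C^{(m+1)}`) — the Hodge
  conjecture for the image AND all its powers.

Nothing is asserted about `HC_AV`; the open content at such a `Y` is `HC_AV` for the powers of the dominating abelian
variety (dimension `≥ 4`, `hc_av_iff_forall_four_le`). [cite: Arapura2006, §1 Lemma 1.1, Cor. 1.2, Lemma 1.3 and §4 Lemma 4.2]
[cite: VoisinHodgeI2002, §7.3.2 Lemma 7.28 and Remark 7.29]

## References
* [Arapura2006] D. Arapura, *Motivation for Hodge cycles*, Adv. Math. 207 (2006), no. 2, 762–781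
  (doi 10.1016/j.aim.2006.01.005; arXiv math/0501348), §1 Lemma 1.1, Cor. 1.2, Lemma 1.3, §4 Lemma 4.2.
* [VoisinHodgeI2002] C. Voisin, *Hodge Theory and Complex Algebraic Geometry I*, CUP (2002), §7.3.2 Lemma 7.28,
  Remark 7.29.
* [HatcherAT2002] A. Hatcher, *Algebraic Topology*, CUP (2002), §3.3 Cor. 3.37.
-/

noncomputable section

namespace Summit.HodgeConjecture.CorCM.Stage4

open CategoryTheory MonoidalCategory CartesianMonoidalCategory
open Literature.AlgebraicGeometry Literature.AlgebraicGeometry.Motives Literature.AlgebraicGeometry.HodgeTheory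
open Literature.AlgebraicTopology.SingularHomology
open Summit.HodgeConjecture.HodgeConjecture.Ring2.AbelianAll (IsAlgebraicCorrespondence.comp)

section Surjections

variable {dA dZ dY : ℕ} {A Z Y C C₁ C₂ : SchemeOver ℂ}

/-- **A surjective morphism of smooth projective complex varieties does not increase dimension** (`dim Y ≤ dim Z`
for `f : Z ↠ Y`), read off cohomology: `f^*` is one-to-one in every degree (Voisin I Lemma 7.28, the tree's
`complexBetti_map_injective_of_surjective`), `H^{2 dim Y}(Y(ℂ); ℂ)` is a line (Poincaré duality `b_{2n} = b₀`,
`ComplexPoints.finrank_singularCohomology_eq_of_add_eq`, and `b₀ = 1`, `finrank_complexBetti_zero`), while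
`H^{2 dim Y}(Z(ℂ); ℂ) = 0` if `dim Z < dim Y` (`subsingleton_complexBetti`).
[cite: VoisinHodgeI2002, §7.3.2 Lemma 7.28] [cite: HatcherAT2002, §3.3 Cor. 3.37] -/
theorem dim_le_of_surjective (hZ : IsSmoothProjective dZ Z) (hY : IsSmoothProjective dY Y) (f : Z ⟶ Y)
    [AlgebraicGeometry.Surjective f.left] : dY ≤ dZ := by
  by_contra h
  haveI := subsingleton_complexBetti hZ (show 2 * dZ < 2 * dY by omega)
  haveI : Subsingleton (complexBetti Y (2 * dY)) :=
    (complexBetti_map_injective_of_surjective hY hZ f (2 * dY)).subsingleton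
  have h1 : Module.finrank ℂ (complexBetti Y (2 * dY)) = 1 := by
    change Module.finrank ℂ (singularCohomology ℂ ℂ (ComplexPoints Y) (2 * dY)) = 1
    rw [ComplexPoints.finrank_singularCohomology_eq_of_add_eq ℂ hY (p := 2 * dY) (q := 0) (by omega)]
    exact finrank_complexBetti_zero hY
  have h0 : Module.finrank ℂ (complexBetti Y (2 * dY)) = 0 := Module.finrank_zero_of_subsingleton
  omega

/-- **Domination descends along surjective morphisms** (Arapura 2006 §1 Cor. 1.2 — "`Y` is motivated by `X` if there
exists a surjective morphism of varieties `f : Xⁿ → Y`"; proof: "… `f_*` is also surjective" — on the real carriers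
and for any dominated source): if `Z` is dominated by the powers of `A` and `f : Z ⟶ Y` is a surjective morphism
of smooth projective complex varieties, then `Y` is dominated by the powers of `A`.  Every class on `Y` is `f_* z`
(`complexGysin_surjective_of_surjective`: Voisin I Lemma 7.28 transposed by Poincaré duality — the printed
`(1/deg h) h^*`-splitting after cutting `Z` down to `dim Y` is not needed), `z` is a combination of values `T x` of
algebraic correspondences `T` from powers `Aᵉ`, and `f_* ∘ T` is again an algebraic correspondence
(`isAlgebraicCorrespondence_complexGysin`, `IsAlgebraicCorrespondence.comp`).
[cite: Arapura2006, §1 Lemma 1.1 and Cor. 1.2] [cite: VoisinHodgeI2002, §7.3.2 Lemma 7.28 and Remark 7.29] -/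
theorem isDominatedByPowers_of_surjective (hA : IsSmoothProjective dA A) (hZ : IsSmoothProjective dZ Z)
    (hY : IsSmoothProjective dY Y) (f : Z ⟶ Y) [AlgebraicGeometry.Surjective f.left]
    (hdom : IsDominatedByPowers dZ Z dA A) : IsDominatedByPowers dY Y dA A := by
  have hd : dY ≤ dZ := dim_le_of_surjective hZ hY f
  intro k
  refine eq_top_iff.2 fun c _ ↦ ?_
  by_cases hk : k ≤ 2 * dY
  swap
  · haveI := subsingleton_complexBetti hY (k := k) (by omega)
    rw [Subsingleton.elim c 0]
    exact Submodule.zero_mem _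
  -- `f_* : H^{k + 2(dZ - dY)}(Z(ℂ)) → Hᵏ(Y(ℂ))`, onto and algebraic
  have hab : (k + 2 * (dZ - dY)) + 2 * dY = k + 2 * dZ := by omega
  have hG : Function.Surjective (complexGysin complexOrientationFamily hZ hY f hab) :=
    complexGysin_surjective_of_surjective complexOrientationFamily hZ hY f hab
  have hGalg : IsAlgebraicCorrespondence dY dZ Y Z (complexGysin complexOrientationFamily hZ hY f hab) :=
    isAlgebraicCorrespondence_complexGysin complexOrientationFamily (OrientationFamily.hasPoincareDuality _) hZ hY f
      hab (q := 2 * dY - k) (by omega)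
  obtain ⟨z, rfl⟩ := hG c
  have hz : z ∈ Submodule.span ℂ
      {c : complexBetti Z (k + 2 * (dZ - dY)) |
        ∃ (e a : ℕ) (T : complexBetti (A.pow e) a →ₗ[ℂ] complexBetti Z (k + 2 * (dZ - dY))),
          IsAlgebraicCorrespondence dZ (e * dA) Z (A.pow e) T ∧ c ∈ LinearMap.range T} := by
    rw [hdom (k + 2 * (dZ - dY))]
    exact Submodule.mem_top
  -- the image of the `Z`-span under `f_*` lies in the `Y`-span
  have key : Submodule.map (complexGysin complexOrientationFamily hZ hY f hab) (Submodule.span ℂ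
      {c : complexBetti Z (k + 2 * (dZ - dY)) |
        ∃ (e a : ℕ) (T : complexBetti (A.pow e) a →ₗ[ℂ] complexBetti Z (k + 2 * (dZ - dY))),
          IsAlgebraicCorrespondence dZ (e * dA) Z (A.pow e) T ∧ c ∈ LinearMap.range T}) ≤
      Submodule.span ℂ
        {c : complexBetti Y k |
          ∃ (e a : ℕ) (T : complexBetti (A.pow e) a →ₗ[ℂ] complexBetti Y k),
            IsAlgebraicCorrespondence dY (e * dA) Y (A.pow e) T ∧ c ∈ LinearMap.range T} := by
    refine (Submodule.map_span_le _ _ _).2 ?_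
    rintro _ ⟨e, a, T, hT, x, rfl⟩
    by_cases ha : a ≤ 2 * (e * dA)
    swap
    · haveI := subsingleton_complexBetti (hA.pow e) (k := a) (by omega)
      rw [Subsingleton.elim x 0, map_zero, map_zero]
      exact Submodule.zero_mem _
    exact Submodule.subset_span ⟨e, a, complexGysin complexOrientationFamily hZ hY f hab ∘ₗ T,
      IsAlgebraicCorrespondence.comp hY hZ (hA.pow e) hT hGalg (by omega), x, rfl⟩
  exact key (Submodule.mem_map_of_mem hz)

/-- Existential packaging: `Z` dominated by SOME abelian variety and `f : Z ↠ Y` ⟹ `Y` dominated by (the same)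
abelian variety. [cite: Arapura2006, §1 Cor. 1.2] -/
theorem exists_isDominatedByPowers_of_surjective (hZ : IsSmoothProjective dZ Z) (hY : IsSmoothProjective dY Y)
    (f : Z ⟶ Y) [AlgebraicGeometry.Surjective f.left]
    (h : ∃ B : AbelianVariety ℂ, IsDominatedByPowers dZ Z B.dim B.X) :
    ∃ B : AbelianVariety ℂ, IsDominatedByPowers dY Y B.dim B.X := by
  obtain ⟨B, hB⟩ := h
  exact ⟨B, isDominatedByPowers_of_surjective AbelianVariety.isSmoothProjective_holds hZ hY f hB⟩

/-- Closure under powers: `Y` dominated by an abelian variety ⟹ so is every `Y^{m+1}` (`isDominatedByPowers_pow_succ`,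
`CorCM/Stage4StrictRoadDischargePowers`). [cite: Arapura2006, §1 Lemma 1.1 and §4 Lemma 4.2] -/
theorem exists_isDominatedByPowers_pow_succ (hY : IsSmoothProjective dY Y)
    (h : ∃ B : AbelianVariety ℂ, IsDominatedByPowers dY Y B.dim B.X) (m : ℕ) :
    ∃ B : AbelianVariety ℂ, IsDominatedByPowers ((m + 1) * dY) (Y.pow (m + 1)) B.dim B.X := by
  obtain ⟨B, hB⟩ := h
  exact ⟨B, isDominatedByPowers_pow_succ AbelianVariety.isSmoothProjective_holds hY hB m⟩

/-- **`HC_AV` ⟹ the Hodge conjecture for every smooth projective complex variety onto which a variety dominated by an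
abelian variety maps, and for all its powers** — Arapura 2006 Cor. 1.2 + Lemma 1.3 + Lemma 4.2 in the kernel, no
record.  Sources `Z` available from `CorCM/Stage4StrictRoadCurves` §4: finite products of curves and abelian varieties and their powers (so: symmetric
powers `C^{(m)}` of curves, smooth quotients `(C₁ × ⋯ × C_r)/G` and `A/G`, every smooth projective image of such a
product). [cite: Arapura2006, §1 Cor. 1.2, Lemma 1.3 and §4 Lemma 4.2] -/
theorem hc_of_surjective_of_exists_isDominatedByPowers (hAV : HC_AV) (hZ : IsSmoothProjective dZ Z)
    (hY : IsSmoothProjective dY Y) (f : Z ⟶ Y) [AlgebraicGeometry.Surjective f.left]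
    (h : ∃ B : AbelianVariety ℂ, IsDominatedByPowers dZ Z B.dim B.X) :
    HodgeConjectureFor dY Y ∧ ∀ m : ℕ, HodgeConjectureFor ((m + 1) * dY) (Y.pow (m + 1)) :=
  hc_of_exists_isDominatedByPowers_abelianVariety hAV hY (exists_isDominatedByPowers_of_surjective hZ hY f h)

/-- Instance (abelian source): a smooth projective `Y` onto which a complex abelian variety maps (e.g. a smooth
quotient `A/G` — bielliptic surfaces —, or any smooth image of `A`) satisfies, GIVEN `HC_AV`, the Hodge conjecture
together with all its powers. [cite: Arapura2006, §1 Cor. 1.2 and §4 Lemma 4.2] -/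
theorem hc_of_surjective_from_abelianVariety (hAV : HC_AV) (B : AbelianVariety ℂ) (hY : IsSmoothProjective dY Y)
    (f : B.X ⟶ Y) [AlgebraicGeometry.Surjective f.left] :
    HodgeConjectureFor dY Y ∧ ∀ m : ℕ, HodgeConjectureFor ((m + 1) * dY) (Y.pow (m + 1)) :=
  hc_of_surjective_of_exists_isDominatedByPowers hAV (AbelianVariety.isSmoothProjective_holds (A := B)) hY f
    (exists_isDominatedByPowers_abelianVariety B)

/-- Instance (two curves): a smooth projective `Y` onto which `C₁ × C₂` maps (curves `Cᵢ`; e.g. `C^{(2)}`,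
`(C₁ × C₂)/G` smooth) satisfies, GIVEN `HC_AV`, the Hodge conjecture together with all its powers `Y^{m+1}`.
[cite: Arapura2006, §1 Cor. 1.2, Lemma 1.3 and §4 Lemma 4.2] -/
theorem hc_of_surjective_from_curve_tensor_curve (hAV : HC_AV) (hC₁ : IsSmoothProjective 1 C₁)
    (hC₂ : IsSmoothProjective 1 C₂) (hY : IsSmoothProjective dY Y) (f : C₁ ⊗ C₂ ⟶ Y)
    [AlgebraicGeometry.Surjective f.left] :
    HodgeConjectureFor dY Y ∧ ∀ m : ℕ, HodgeConjectureFor ((m + 1) * dY) (Y.pow (m + 1)) :=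
  hc_of_surjective_of_exists_isDominatedByPowers hAV (hC₁.tensor_holds hC₂) hY f
    (exists_isDominatedByPowers_tensor hC₁ hC₂ (exists_isDominatedByPowers_curve hC₁)
      (exists_isDominatedByPowers_curve hC₂))

/-- Instance (a power of one curve): a smooth projective `Y` onto which `C^{m+1}` maps (e.g. the symmetric power
`C^{(m+1)} = C^{m+1}/𝔖_{m+1}`, smooth for a smooth curve; smooth quotients `C^{m+1}/G`) satisfies, GIVEN `HC_AV`, the
Hodge conjecture together with all its powers. [cite: Arapura2006, §1 Cor. 1.2, Lemma 1.3 and §4 Lemma 4.2] -/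
theorem hc_of_surjective_from_curve_pow (hAV : HC_AV) (hC : IsSmoothProjective 1 C) (hY : IsSmoothProjective dY Y)
    {m : ℕ} (f : C.pow (m + 1) ⟶ Y) [AlgebraicGeometry.Surjective f.left] :
    HodgeConjectureFor dY Y ∧ ∀ k : ℕ, HodgeConjectureFor ((k + 1) * dY) (Y.pow (k + 1)) := by
  have hCm : IsSmoothProjective ((m + 1) * 1) (C.pow (m + 1)) := hC.pow (m + 1)
  obtain ⟨B, hB⟩ := exists_isDominatedByPowers_pow_succ hC (exists_isDominatedByPowers_curve hC) m
  rw [Nat.mul_one] at hCm hB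
  exact hc_of_surjective_of_exists_isDominatedByPowers hAV hCm hY f ⟨B, hB⟩

end Surjections

end Summit.HodgeConjecture.CorCM.Stage4

end
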